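import Mathlib
import Literature.Geometry.DiscreteGeometry.DelaunaySubdivision
import Literature.Geometry.DiscreteGeometry.GirardSolidAngle
import HarnessLib

/-!
# Girard's formula for a cell of a complex (stub `stub_girardCell`)

Stub `stub_girardCell` of line `Sketch` (idea `par-five-delaunay-recount`) of crux
`SquareWellLayerCake.AveragedTwelve` (`stmt-AtomisticToContinuum-15806`).

CLAIM. For a `4`-vertex simplex `t` of a geometric simplicial complex `K` in `ℝ³` and a vertex
`v ∈ t`, the solid-angle fraction of the apex cone of `t` at `v` (generators `w - v`,
`w ∈ t.erase v`) equals half the sum over `z ∈ t.erase v` of the dihedral fractions of `t` along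
the edges `vz` (wedges `ℝ(z - v) + cone(w - v : w ∈ (t.erase v).erase z)`), minus a quarter.

PROOF IDEA. This is a re-indexing of the tree theorem
`Literature.Geometry.DiscreteGeometry.solidAngleFraction_eq_dihedralFraction`
(`GirardSolidAngle.lean`), which is stated for a linearly independent triple `u : Fin 3 → ℝ³`.
Enumerate `t.erase v = {a, b, c}` (`Finset.card_eq_three`), put `u = ![a - v, b - v, c - v]`
(linearly independent by `linearIndependent_sub_of_mem_faces`, i.e. affine independence of the
vertices of a simplex), and use that `apexCone v (u ∘ e) = apexCone v u`,
`apexWedge v d (u ∘ e) = apexWedge v d u` for an equivalence `e` of index types.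
-/

noncomputable section

namespace Summit.AtomisticToContinuum.Crystallization.Theorems.ParFiveRecountGirardCell

open Literature.Geometry.DiscreteGeometry

/-! ### Re-indexing invariance of apex cones and wedges -/

/-- Re-indexing the generators along an equivalence does not change the apex cone. [folklore] -/
theorem apexCone_comp_equiv {V : Type*} [AddCommGroup V] [Module ℝ V] {ι ι' : Type*}
    [Fintype ι] [Fintype ι'] (v : V) (u : ι' → V) (e : ι ≃ ι') :
    apexCone v (u ∘ e) = apexCone v u := by
  ext q
  simp only [mem_apexCone_iff, Function.comp_apply]
  constructor
  · rintro ⟨c, hc, rfl⟩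
    refine ⟨c ∘ e.symm, fun i => hc _, ?_⟩
    rw [← e.sum_comp]
    simp
  · rintro ⟨c, hc, rfl⟩
    refine ⟨c ∘ e, fun i => hc _, ?_⟩
    rw [← e.sum_comp (fun j => c j • u j)]
    simp

/-- Re-indexing the generators along an equivalence does not change the apex wedge. [folklore] -/
theorem apexWedge_comp_equiv {V : Type*} [AddCommGroup V] [Module ℝ V] {ι ι' : Type*}
    [Fintype ι] [Fintype ι'] (v d : V) (u : ι' → V) (e : ι ≃ ι') :
    apexWedge v d (u ∘ e) = apexWedge v d u := by
  ext q
  simp only [mem_apexWedge_iff, Function.comp_apply]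
  constructor
  · rintro ⟨s, c, hc, rfl⟩
    refine ⟨s, c ∘ e.symm, fun i => hc _, ?_⟩
    rw [← e.sum_comp]
    simp
  · rintro ⟨s, c, hc, rfl⟩
    refine ⟨s, c ∘ e, fun i => hc _, ?_⟩
    rw [← e.sum_comp (fun j => c j • u j)]
    simp

/-- An injective enumeration `f` of a finset `s` gives an equivalence `ι ≃ ↥s` over `f`.
[folklore] -/
theorem exists_equiv_coe_eq {E : Type*} {ι : Type*} (f : ι → E) (hf : Function.Injective f)
    (s : Finset E) (hs : ∀ w, w ∈ s ↔ ∃ i, f i = w) :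
    ∃ e : ι ≃ ↥s, ∀ i, ((e i : ↥s) : E) = f i :=
  ⟨(Equiv.ofInjective f hf).trans (Equiv.subtypeEquivRight fun w => (hs w).symm), fun i => by
    simp⟩

/-- The apex cone generated by `g` over a finset enumerated injectively by `f` is the apex cone
of the family `g ∘ f`. [folklore] -/
theorem apexCone_coe_eq_comp {V : Type*} [AddCommGroup V] [Module ℝ V] {E : Type*} {ι : Type*}
    [Fintype ι] (v : V) (g : E → V) (f : ι → E) (hf : Function.Injective f) (s : Finset E)
    (hs : ∀ w, w ∈ s ↔ ∃ i, f i = w) :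
    apexCone v (fun w : ↥s => g (w : E)) = apexCone v (g ∘ f) := by
  obtain ⟨e, he⟩ := exists_equiv_coe_eq f hf s hs
  rw [← apexCone_comp_equiv v (fun w : ↥s => g (w : E)) e]
  congr 1
  funext i
  simp [he]

/-- The apex wedge generated by `g` over a finset enumerated injectively by `f` is the apex
wedge of the family `g ∘ f`. [folklore] -/
theorem apexWedge_coe_eq_comp {V : Type*} [AddCommGroup V] [Module ℝ V] {E : Type*} {ι : Type*}
    [Fintype ι] (v d : V) (g : E → V) (f : ι → E) (hf : Function.Injective f) (s : Finset E)
    (hs : ∀ w, w ∈ s ↔ ∃ i, f i = w) :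
    apexWedge v d (fun w : ↥s => g (w : E)) = apexWedge v d (g ∘ f) := by
  obtain ⟨e, he⟩ := exists_equiv_coe_eq f hf s hs
  rw [← apexWedge_comp_equiv v d (fun w : ↥s => g (w : E)) e]
  congr 1
  funext i
  simp [he]

/-- Linear independence of `g` over a finset enumerated injectively by `f` transfers to the
family `g ∘ f`. [folklore] -/
theorem linearIndependent_comp_of_coe {V : Type*} [AddCommGroup V] [Module ℝ V] {E : Type*}
    {ι : Type*} (g : E → V) (f : ι → E) (hf : Function.Injective f) (s : Finset E)
    (hs : ∀ w, w ∈ s ↔ ∃ i, f i = w)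
    (hli : LinearIndependent ℝ (fun w : ↥s => g (w : E))) :
    LinearIndependent ℝ (g ∘ f) := by
  obtain ⟨e, he⟩ := exists_equiv_coe_eq f hf s hs
  have h := hli.comp e e.injective
  convert h using 1
  funext i
  simp [he]

/-! ### Enumerations of pairs and triples -/

/-- The apex wedge generated by `g` over a two-element finset `{x, y}` is the apex wedge of the
pair `![g x, g y]`. [folklore] -/
theorem apexWedge_coe_pair {V : Type*} [AddCommGroup V] [Module ℝ V] {E : Type*} (v d : V)
    (g : E → V) {x y : E} (hxy : x ≠ y) (s : Finset E)
    (hs : ∀ w, w ∈ s ↔ w = x ∨ w = y) :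
    apexWedge v d (fun w : ↥s => g (w : E)) = apexWedge v d ![g x, g y] := by
  have hf : Function.Injective ![x, y] := by
    intro i j hij
    fin_cases i <;> fin_cases j <;> simp_all [eq_comm]
  have hs' : ∀ w, w ∈ s ↔ ∃ i, ![x, y] i = w := fun w => by
    rw [hs]
    constructor
    · rintro (rfl | rfl)
      exacts [⟨0, rfl⟩, ⟨1, rfl⟩]
    · rintro ⟨i, rfl⟩
      fin_cases i <;> simp
  rw [apexWedge_coe_eq_comp v d g ![x, y] hf s hs']
  congr 1
  funext i
  fin_cases i <;> rfl

/-- The apex cone generated by `g` over a three-element finset `{x, y, z}` is the apex cone of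
the triple `![g x, g y, g z]`. [folklore] -/
theorem apexCone_coe_triple {V : Type*} [AddCommGroup V] [Module ℝ V] {E : Type*} (v : V)
    (g : E → V) {x y z : E} (hxy : x ≠ y) (hxz : x ≠ z) (hyz : y ≠ z) (s : Finset E)
    (hs : ∀ w, w ∈ s ↔ w = x ∨ w = y ∨ w = z) :
    apexCone v (fun w : ↥s => g (w : E)) = apexCone v ![g x, g y, g z] := by
  have hf : Function.Injective ![x, y, z] := by
    intro i j hij
    fin_cases i <;> fin_cases j <;> simp_all [eq_comm]
  have hs' : ∀ w, w ∈ s ↔ ∃ i, ![x, y, z] i = w := fun w => by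
    rw [hs]
    constructor
    · rintro (rfl | rfl | rfl)
      exacts [⟨0, rfl⟩, ⟨1, rfl⟩, ⟨2, rfl⟩]
    · rintro ⟨i, rfl⟩
      fin_cases i <;> simp
  rw [apexCone_coe_eq_comp v g ![x, y, z] hf s hs']
  congr 1
  funext i
  fin_cases i <;> rfl

/-- Linear independence of `g` over a three-element finset `{x, y, z}` is linear independence
of the triple `![g x, g y, g z]`. [folklore] -/
theorem linearIndependent_triple_of_coe {V : Type*} [AddCommGroup V] [Module ℝ V] {E : Type*}
    (g : E → V) {x y z : E} (hxy : x ≠ y) (hxz : x ≠ z) (hyz : y ≠ z) (s : Finset E)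
    (hs : ∀ w, w ∈ s ↔ w = x ∨ w = y ∨ w = z)
    (hli : LinearIndependent ℝ (fun w : ↥s => g (w : E))) :
    LinearIndependent ℝ ![g x, g y, g z] := by
  have hf : Function.Injective ![x, y, z] := by
    intro i j hij
    fin_cases i <;> fin_cases j <;> simp_all [eq_comm]
  have hs' : ∀ w, w ∈ s ↔ ∃ i, ![x, y, z] i = w := fun w => by
    rw [hs]
    constructor
    · rintro (rfl | rfl | rfl)
      exacts [⟨0, rfl⟩, ⟨1, rfl⟩, ⟨2, rfl⟩]
    · rintro ⟨i, rfl⟩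
      fin_cases i <;> simp
  have h := linearIndependent_comp_of_coe g ![x, y, z] hf s hs' hli
  convert h using 1
  funext i
  fin_cases i <;> rfl

/-! ### The statement -/

/-- **Girard's formula for a cell of a complex** (permutation-free form): for a `4`-vertex
simplex `t` of a geometric simplicial complex in `ℝ³` and a vertex `v ∈ t`, the solid-angle
fraction of the apex cone of `t` at `v` is half the sum of the three dihedral fractions of `t`
along the edges `vz`, `z ∈ t ∖ {v}`, minus a quarter. -/
theorem stub_girardCell : ∀ (K : Geometry.SimplicialComplex ℝ (EuclideanSpace ℝ (Fin 3))) (t : Finset (EuclideanSpace ℝ (Fin 3))), t ∈ K.faces → t.card = 4 → ∀ v ∈ t, Literature.Geometry.DiscreteGeometry.ballFraction v (Literature.Geometry.DiscreteGeometry.apexCone v (fun w : ↥((t).erase v) => (↑w : EuclideanSpace ℝ (Fin 3)) - v)) = (∑ z ∈ t.erase v, Literature.Geometry.DiscreteGeometry.ballFraction v (Literature.Geometry.DiscreteGeometry.apexWedge v (z - v) (fun w : ↥(((t).erase v).erase z) => (↑w : EuclideanSpace ℝ (Fin 3)) - v))) / 2 - 1 / 4 := by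
  intro K t ht hcard v hv
  -- enumerate `t.erase v = {a, b, c}` and rewrite it everywhere
  have h3 : (t.erase v).card = 3 := by
    rw [Finset.card_erase_of_mem hv, hcard]
  have hli0 := linearIndependent_sub_of_mem_faces (K := K) ht hv
  obtain ⟨a, b, c, hab, hac, hbc, hs⟩ := Finset.card_eq_three.1 h3
  rw [hs] at hli0
  rw [hs]
  -- membership in the enumerated finsets
  have hmem : ∀ w, w ∈ ({a, b, c} : Finset (EuclideanSpace ℝ (Fin 3))) ↔
      w = a ∨ w = b ∨ w = c := fun w => by
    simp
  have hmem_a : ∀ w, w ∈ ({a, b, c} : Finset (EuclideanSpace ℝ (Fin 3))).erase a ↔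
      w = b ∨ w = c := fun w => by
    simp only [Finset.mem_erase, Finset.mem_insert, Finset.mem_singleton]
    constructor
    · rintro ⟨h1, rfl | rfl | rfl⟩
      · exact absurd rfl h1
      · exact Or.inl rfl
      · exact Or.inr rfl
    · rintro (rfl | rfl)
      · exact ⟨fun h => hab h.symm, Or.inr (Or.inl rfl)⟩
      · exact ⟨fun h => hac h.symm, Or.inr (Or.inr rfl)⟩
  have hmem_b : ∀ w, w ∈ ({a, b, c} : Finset (EuclideanSpace ℝ (Fin 3))).erase b ↔
      w = a ∨ w = c := fun w => by
    simp only [Finset.mem_erase, Finset.mem_insert, Finset.mem_singleton]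
    constructor
    · rintro ⟨h1, rfl | rfl | rfl⟩
      · exact Or.inl rfl
      · exact absurd rfl h1
      · exact Or.inr rfl
    · rintro (rfl | rfl)
      · exact ⟨hab, Or.inl rfl⟩
      · exact ⟨fun h => hbc h.symm, Or.inr (Or.inr rfl)⟩
  have hmem_c : ∀ w, w ∈ ({a, b, c} : Finset (EuclideanSpace ℝ (Fin 3))).erase c ↔
      w = a ∨ w = b := fun w => by
    simp only [Finset.mem_erase, Finset.mem_insert, Finset.mem_singleton]
    constructor
    · rintro ⟨h1, rfl | rfl | rfl⟩
      · exact Or.inl rfl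
      · exact Or.inr rfl
      · exact absurd rfl h1
    · rintro (rfl | rfl)
      · exact ⟨hac, Or.inl rfl⟩
      · exact ⟨hbc, Or.inr (Or.inl rfl)⟩
  -- linear independence of the edge vectors and Girard's formula from the tree
  have hli : LinearIndependent ℝ ![a - v, b - v, c - v] :=
    linearIndependent_triple_of_coe (fun x => x - v) hab hac hbc _ hmem hli0
  have hG := solidAngleFraction_eq_dihedralFraction v ![a - v, b - v, c - v] hli
  simp only [solidAngleFraction, dihedralFraction, Matrix.cons_val_zero, Matrix.cons_val_one,
    Matrix.head_cons, Matrix.cons_val_two, Matrix.tail_cons, add_sub_cancel_left] at hG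
  -- expand the sum over `{a, b, c}` and re-index the cone and the three wedges
  have hnot : a ∉ ({b, c} : Finset (EuclideanSpace ℝ (Fin 3))) := by
    simp only [Finset.mem_insert, Finset.mem_singleton, not_or]
    exact ⟨hab, hac⟩
  have hnot' : b ∉ ({c} : Finset (EuclideanSpace ℝ (Fin 3))) := by
    simpa using hbc
  rw [Finset.sum_insert hnot, Finset.sum_insert hnot', Finset.sum_singleton,
    apexCone_coe_triple v (fun x => x - v) hab hac hbc _ hmem,
    apexWedge_coe_pair v (a - v) (fun x => x - v) hbc _ hmem_a,
    apexWedge_coe_pair v (b - v) (fun x => x - v) hac _ hmem_b,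
    apexWedge_coe_pair v (c - v) (fun x => x - v) hab _ hmem_c, hG, add_assoc]

end Summit.AtomisticToContinuum.Crystallization.Theorems.ParFiveRecountGirardCell

end
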